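import Summits.CriticalPhenomena.PercolationContinuityZ3.Theorems.PercNearOneGluingNoHeavyLowerTailSahiCTCLadderRowsA
import HarnessLib

/-!
# `NoHeavyLowerTail` (crux stmt-CriticalPhenomena-4575), P3 lane: the row with two doubled points of the ladder inequality, in Kleitman-surplus form
# (memo g25 §3 (iv))

Support file (seat `prim-l12-p3`, gen 25; `--supports stmt-CriticalPhenomena-4575`).  For 2-live up-sets `𝒳, 𝒵`, `a ≠ b` outside `T` (`t = #T`,
`N_a, N_b` = common neighbours of `a`, `b` in `T`):
    `[ab common]·(1 + [t ≥ 1](t+2)) + [t ≥ 1](#N_a + #N_b) ≤ κ(∅, ab ∪ T) + Σ_{y∈T} (κ({b}, a ∪ T − y) + κ({a}, b ∪ T − y))`   (`row_two`),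
from the DEGREE lemma at `a` and `b`, the LOOP lemma on the based cubes, and the TRIANGLE lemma when `a, b` are commonly adjacent to all of `T`.
Nothing is asserted about the crux.
-/

namespace Summit.CriticalPhenomena.PercolationContinuityZ3.Theorems.SahiCTCForms

open Finset

variable {α : Type*} [DecidableEq α]

section RowTwo
variable {𝒳 𝒵 : Finset (Finset α)}

/-- Row (iv), the case `{a,b}` NOT common, one side: if `a` has a common neighbour in `T` then
`#N_a + #N_b ≤ κ(∅, ab ∪ T) + Σ_{y∈T} κ({a}, b ∪ T − y)`. [this work] -/
theorem row_two_aux (h𝒳 : IsUpperSet (𝒳 : Set (Finset α))) (h𝒵 : IsUpperSet (𝒵 : Set (Finset α)))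
    (hX2 : ∀ U ∈ 𝒳, 2 ≤ #U) (hZ2 : ∀ U ∈ 𝒵, 2 ≤ #U) {a b : α} (hab : a ≠ b) {T : Finset α} (haT : a ∉ T) (hbT : b ∉ T)
    (hnot : ¬ (({a, b} : Finset α) ∈ 𝒳 ∧ ({a, b} : Finset α) ∈ 𝒵)) (hNa : (cnbrs 𝒳 𝒵 (insert a T) a).Nonempty) :
    (#(cnbrs 𝒳 𝒵 (insert a T) a) : ℤ) + #(cnbrs 𝒳 𝒵 (insert b T) b) ≤
      kap 𝒳 𝒵 ∅ (insert a (insert b T)) + ∑ y ∈ T, kap 𝒳 𝒵 {a} (insert b (T.erase y)) := by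
  have haX : ({a} : Finset α) ∉ 𝒳 := fun h => by have := hX2 _ h; simp at this
  have haZ : ({a} : Finset α) ∉ 𝒵 := fun h => by have := hZ2 _ h; simp at this
  have habT : a ∉ insert b T := by rw [mem_insert, not_or]; exact ⟨hab, haT⟩
  -- the common neighbours of a in ab ∪ T are exactly Na (b is not one)
  have hcn : cnbrs 𝒳 𝒵 (insert a (insert b T)) a = cnbrs 𝒳 𝒵 (insert a T) a := by
    unfold cnbrs; rw [erase_insert habT, erase_insert haT, filter_insert, if_neg hnot]
  have hNaT : cnbrs 𝒳 𝒵 (insert a T) a ⊆ T := fun y hy => ((mem_cnbrs_insert haT).1 hy).1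
  have hT1 : 1 ≤ #T := by obtain ⟨u, hu⟩ := hNa; exact card_pos.2 ⟨u, hNaT hu⟩
  have hNbT : cnbrs 𝒳 𝒵 (insert b T) b ⊆ T := fun y hy => ((mem_cnbrs_insert hbT).1 hy).1
  -- DEGREE at a
  have hdeg : (#(cnbrs 𝒳 𝒵 (insert a T) a) : ℤ) + 1 ≤ kap 𝒳 𝒵 ∅ (insert a (insert b T)) := by
    have h := card_cnbrs_add_one_le_kap h𝒳 h𝒵 hX2 hZ2 _ (insert a (insert b T)) a rfl
      (by rw [card_insert_of_notMem habT, card_insert_of_notMem hbT]; omega) (mem_insert_self _ _) (by rw [hcn]; exact hNa)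
    rw [hcn] at h; exact h
  -- based cubes at a: a loop whenever Na has a point other than y
  have hT2 := card_sub_le_sum (S := T) (X := if 2 ≤ #(cnbrs 𝒳 𝒵 (insert a T) a) then ∅ else cnbrs 𝒳 𝒵 (insert a T) a)
    (f := fun y => kap 𝒳 𝒵 {a} (insert b (T.erase y)))
    (fun y hy => kap_nonneg h𝒳 h𝒵 _ _ (by
      rw [disjoint_singleton_left, mem_insert, not_or]; exact ⟨hab, fun h => haT (mem_of_mem_erase h)⟩))
    (fun y hy hyX => by
      -- find u ∈ Na with u ≠ y
      have : ∃ u ∈ cnbrs 𝒳 𝒵 (insert a T) a, u ≠ y := by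
        split_ifs at hyX with h2
        · obtain ⟨u, u', hu, hu', huu'⟩ := one_lt_card_iff.1 h2
          by_cases huy : u = y
          · exact ⟨u', hu', fun h => huu' (huy.trans h.symm)⟩
          · exact ⟨u, hu, huy⟩
        · obtain ⟨u, hu⟩ := hNa; exact ⟨u, hu, fun h => hyX (h ▸ hu)⟩
      obtain ⟨u, hu, huy⟩ := this
      obtain ⟨huT, hX, hZ⟩ := (mem_cnbrs_insert haT).1 hu
      rw [pair_comm] at hX hZ
      exact one_le_kap_of_loop h𝒳 h𝒵 haX haZ (mem_insert_of_mem (mem_erase.2 ⟨huy, huT⟩)) hX hZ)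
  beta_reduce at hT2
  have hNb : (#(cnbrs 𝒳 𝒵 (insert b T) b) : ℤ) ≤ #T := by exact_mod_cast card_le_card hNbT
  split_ifs at hT2 with h2
  · rw [card_empty, Nat.cast_zero, sub_zero] at hT2; linarith
  · have : (#(cnbrs 𝒳 𝒵 (insert a T) a) : ℤ) = 1 := by
      exact_mod_cast (by have := card_pos.2 hNa; omega : #(cnbrs 𝒳 𝒵 (insert a T) a) = 1)
    rw [this] at hT2 ⊢; linarith

/-- **Row (iv) in Kleitman-surplus form** (memo g25 §3 (iv)): for 2-live up-sets, `a ≠ b` outside `T` (`t = #T`),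
`[ab common]·(1 + [t ≥ 1](t+2)) + [t ≥ 1](#N_a + #N_b) ≤ κ(∅, ab ∪ T) + Σ_{y∈T} (κ({b}, a ∪ T − y) + κ({a}, b ∪ T − y))`. [this work] -/
theorem row_two (h𝒳 : IsUpperSet (𝒳 : Set (Finset α))) (h𝒵 : IsUpperSet (𝒵 : Set (Finset α)))
    (hX2 : ∀ U ∈ 𝒳, 2 ≤ #U) (hZ2 : ∀ U ∈ 𝒵, 2 ≤ #U) {a b : α} (hab : a ≠ b) {T : Finset α} (haT : a ∉ T) (hbT : b ∉ T) :
    (if ({a, b} : Finset α) ∈ 𝒳 ∧ ({a, b} : Finset α) ∈ 𝒵 then (1 : ℤ) + (if 1 ≤ #T then (#T : ℤ) + 2 else 0) else 0)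
      + (if 1 ≤ #T then (#(cnbrs 𝒳 𝒵 (insert a T) a) : ℤ) + #(cnbrs 𝒳 𝒵 (insert b T) b) else 0)
      ≤ kap 𝒳 𝒵 ∅ (insert a (insert b T))
        + ∑ y ∈ T, (kap 𝒳 𝒵 {b} (insert a (T.erase y)) + kap 𝒳 𝒵 {a} (insert b (T.erase y))) := by
  have habT : a ∉ insert b T := by rw [mem_insert, not_or]; exact ⟨hab, haT⟩
  have hbaT : b ∉ insert a T := by rw [mem_insert, not_or]; exact ⟨hab.symm, hbT⟩
  have hcomm : insert a (insert b T) = insert b (insert a T) := Finset.insert_comm a b T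
  have haX : ({a} : Finset α) ∉ 𝒳 := fun h => by have := hX2 _ h; simp at this
  have haZ : ({a} : Finset α) ∉ 𝒵 := fun h => by have := hZ2 _ h; simp at this
  have hbX : ({b} : Finset α) ∉ 𝒳 := fun h => by have := hX2 _ h; simp at this
  have hbZ : ({b} : Finset α) ∉ 𝒵 := fun h => by have := hZ2 _ h; simp at this
  have h0 : 0 ≤ kap 𝒳 𝒵 ∅ (insert a (insert b T)) := kap_nonneg h𝒳 h𝒵 _ _ (disjoint_empty_left _)
  have h0b : ∀ y ∈ T, 0 ≤ kap 𝒳 𝒵 {b} (insert a (T.erase y)) := fun y hy => kap_nonneg h𝒳 h𝒵 _ _ (by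
    rw [disjoint_singleton_left, mem_insert, not_or]; exact ⟨hab.symm, fun h => hbT (mem_of_mem_erase h)⟩)
  have h0a : ∀ y ∈ T, 0 ≤ kap 𝒳 𝒵 {a} (insert b (T.erase y)) := fun y hy => kap_nonneg h𝒳 h𝒵 _ _ (by
    rw [disjoint_singleton_left, mem_insert, not_or]; exact ⟨hab, fun h => haT (mem_of_mem_erase h)⟩)
  have hsb : 0 ≤ ∑ y ∈ T, kap 𝒳 𝒵 {b} (insert a (T.erase y)) := sum_nonneg h0b
  have hsa : 0 ≤ ∑ y ∈ T, kap 𝒳 𝒵 {a} (insert b (T.erase y)) := sum_nonneg h0a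
  rw [sum_add_distrib]
  have hNaT : cnbrs 𝒳 𝒵 (insert a T) a ⊆ T := fun y hy => ((mem_cnbrs_insert haT).1 hy).1
  have hNbT : cnbrs 𝒳 𝒵 (insert b T) b ⊆ T := fun y hy => ((mem_cnbrs_insert hbT).1 hy).1
  have hNale : (#(cnbrs 𝒳 𝒵 (insert a T) a) : ℤ) ≤ #T := by exact_mod_cast card_le_card hNaT
  have hNble : (#(cnbrs 𝒳 𝒵 (insert b T) b) : ℤ) ≤ #T := by exact_mod_cast card_le_card hNbT
  by_cases hT0 : #T = 0
  · -- t = 0: κ(∅, {a,b}) = [ab common]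
    have hT : T = ∅ := card_eq_zero.1 hT0
    subst hT
    have hne1 : ¬ (1 ≤ #(∅ : Finset α)) := by simp
    simp only [hne1, if_false, add_zero, sum_empty]
    rw [show insert a (insert b (∅ : Finset α)) = {a, b} from rfl, kap_empty_pair_eq hX2 hZ2 (card_pair hab)]
  have hT1 : 1 ≤ #T := by omega
  rw [if_pos hT1, if_pos hT1]
  by_cases hcom : ({a, b} : Finset α) ∈ 𝒳 ∧ ({a, b} : Finset α) ∈ 𝒵
  · rw [if_pos hcom]
    -- based cubes: the loop a (resp. b) in every cube
    have hTb : (#T : ℤ) - #(∅ : Finset α) ≤ ∑ y ∈ T, kap 𝒳 𝒵 {b} (insert a (T.erase y)) :=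
      card_sub_le_sum h0b fun y hy _ =>
        one_le_kap_of_loop h𝒳 h𝒵 hbX hbZ (mem_insert_self a _) hcom.1 hcom.2
    have hTa : (#T : ℤ) - #(∅ : Finset α) ≤ ∑ y ∈ T, kap 𝒳 𝒵 {a} (insert b (T.erase y)) :=
      card_sub_le_sum h0a fun y hy _ => by
        have h1 := hcom.1; have h2 := hcom.2
        rw [pair_comm] at h1 h2
        exact one_le_kap_of_loop h𝒳 h𝒵 haX haZ (mem_insert_self b _) h1 h2
    rw [card_empty, Nat.cast_zero, sub_zero] at hTb hTa
    -- DEGREE at a and at b: the common neighbours of a in ab ∪ T are b and Na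
    have hcna : cnbrs 𝒳 𝒵 (insert a (insert b T)) a = insert b (cnbrs 𝒳 𝒵 (insert a T) a) := by
      unfold cnbrs; rw [erase_insert habT, erase_insert haT, filter_insert, if_pos hcom]
    have hcnb : cnbrs 𝒳 𝒵 (insert b (insert a T)) b = insert a (cnbrs 𝒳 𝒵 (insert b T) b) := by
      have hcom' : ({b, a} : Finset α) ∈ 𝒳 ∧ ({b, a} : Finset α) ∈ 𝒵 := by rw [pair_comm]; exact hcom
      unfold cnbrs; rw [erase_insert hbaT, erase_insert hbT, filter_insert, if_pos hcom']
    have hcard : #(insert a (insert b T)) = #T + 2 := by rw [card_insert_of_notMem habT, card_insert_of_notMem hbT]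
    have hdega := card_cnbrs_add_one_le_kap h𝒳 h𝒵 hX2 hZ2 _ (insert a (insert b T)) a rfl (by rw [hcard]; omega)
      (mem_insert_self _ _) (by rw [hcna]; exact insert_nonempty _ _)
    have hdegb := card_cnbrs_add_one_le_kap h𝒳 h𝒵 hX2 hZ2 _ (insert b (insert a T)) b rfl (by rw [← hcomm, hcard]; omega)
      (mem_insert_self _ _) (by rw [hcnb]; exact insert_nonempty _ _)
    rw [hcna, card_insert_of_notMem fun h => hbT (hNaT h)] at hdega
    rw [hcnb, card_insert_of_notMem fun h => haT (hNbT h), ← hcomm] at hdegb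
    push_cast at hdega hdegb
    -- if both a and b are commonly adjacent to all of T: triangle
    by_cases hfull : #(cnbrs 𝒳 𝒵 (insert a T) a) = #T ∧ #(cnbrs 𝒳 𝒵 (insert b T) b) = #T
    · obtain ⟨y, hy⟩ : T.Nonempty := card_pos.1 hT1
      have hyNa : y ∈ cnbrs 𝒳 𝒵 (insert a T) a := by rw [eq_of_subset_of_card_le hNaT hfull.1.ge]; exact hy
      have hyNb : y ∈ cnbrs 𝒳 𝒵 (insert b T) b := by rw [eq_of_subset_of_card_le hNbT hfull.2.ge]; exact hy
      obtain ⟨_, haX', haZ'⟩ := (mem_cnbrs_insert haT).1 hyNa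
      obtain ⟨_, hbX', hbZ'⟩ := (mem_cnbrs_insert hbT).1 hyNb
      have hay : a ≠ y := fun h => haT (h ▸ hy)
      have hby : b ≠ y := fun h => hbT (h ▸ hy)
      have htri := card_add_one_le_kap_of_triangle h𝒳 h𝒵 hX2 hZ2 (s := insert a (insert b T)) (mem_insert_self _ _)
        (mem_insert_of_mem (mem_insert_self _ _)) (mem_insert_of_mem (mem_insert_of_mem hy)) (mem_inter.2 hcom)
        (mem_inter.2 ⟨hbX', hbZ'⟩) (mem_inter.2 ⟨haX', haZ'⟩) hab hby hay
      rw [hcard] at htri; push_cast at htri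
      have e1 : (#(cnbrs 𝒳 𝒵 (insert a T) a) : ℤ) = #T := by exact_mod_cast hfull.1
      have e2 : (#(cnbrs 𝒳 𝒵 (insert b T) b) : ℤ) = #T := by exact_mod_cast hfull.2
      linarith
    · -- otherwise min(#Na, #Nb) ≤ t − 1
      rcases not_and_or.1 hfull with hna | hnb
      · have : (#(cnbrs 𝒳 𝒵 (insert a T) a) : ℤ) ≤ #T - 1 := by
          have : #(cnbrs 𝒳 𝒵 (insert a T) a) < #T := lt_of_le_of_ne (card_le_card hNaT) hna
          have h1 : 1 ≤ #T := hT1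
          have := (Nat.cast_le (α := ℤ)).2 (Nat.le_sub_one_of_lt this); push_cast [Nat.cast_sub h1] at this; exact this
        linarith
      · have : (#(cnbrs 𝒳 𝒵 (insert b T) b) : ℤ) ≤ #T - 1 := by
          have : #(cnbrs 𝒳 𝒵 (insert b T) b) < #T := lt_of_le_of_ne (card_le_card hNbT) hnb
          have h1 : 1 ≤ #T := hT1
          have := (Nat.cast_le (α := ℤ)).2 (Nat.le_sub_one_of_lt this); push_cast [Nat.cast_sub h1] at this; exact this
        linarith
  · rw [if_neg hcom, zero_add]
    by_cases hNa0 : (cnbrs 𝒳 𝒵 (insert a T) a).Nonempty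
    · have := row_two_aux h𝒳 h𝒵 hX2 hZ2 hab haT hbT hcom hNa0
      linarith
    by_cases hNb0 : (cnbrs 𝒳 𝒵 (insert b T) b).Nonempty
    · have hcom' : ¬ (({b, a} : Finset α) ∈ 𝒳 ∧ ({b, a} : Finset α) ∈ 𝒵) := by rw [pair_comm]; exact hcom
      have := row_two_aux h𝒳 h𝒵 hX2 hZ2 hab.symm hbT haT hcom' hNb0
      rw [← hcomm] at this
      linarith
    rw [not_nonempty_iff_eq_empty.1 hNa0, not_nonempty_iff_eq_empty.1 hNb0, card_empty, Nat.cast_zero, add_zero]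
    linarith

end RowTwo

end Summit.CriticalPhenomena.PercolationContinuityZ3.Theorems.SahiCTCForms
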